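import Summits.AnomalousDissipation.AnomalousDissipation.Theorems.BaireTransferRobustLoudUpgradePoly

/-!
# Line `malkin-cone-group-orbits`, skeleton c14 v3 (lead `…-1144-c14-0`) for the crux `BaireTransfer.RobustLoudUpgrade`
# (stmt-AnomalousDissipation-1144): THE DESIGNER SEGMENT INSIDE `P_S` — skeleton v4, after waves 1–2 (all eight engine stubs landed)

State after waves 1–2 (2026-08-17T07:45Z): the reshape c14 is LANDED except its residual —
`Theorems/BaireTransferRobustLoudUpgradeLinePolyDefs.lean` (p142960: `polySteady`, `tamePoly`, `line_glue_c14`),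
`…StubEigenFinite` (p143599, Riesz–Schauder), `…StubRealKernel` (p143779), `…StubSegmentNondeg` (p143936), `…StubSegmentSteady` (p143727),
`…StubSegmentBudget` (p143611), `…StubTruncate` (p144622), and the assembly `…Poly.lean` (`polySteady_subset_closure_interior_loud`:
polynomial steady witnesses of any mean are TAME with no visibility hypothesis; `tamePoly_subset_closure_interior_loud`;
`RobustLoudUpgrade_iff_wild_c14`: the crux is EQUIVALENT to the wild residual over `tamePoly`; `stockEnlarged_steady_upgrade`: census door R3 in
the finite vocabulary; `cLam_mem_polySteady`: non-vacuity at every Grashof number), `…StubSegmentSteadyForce` (p146671),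
`…StubPersistSmoothForce` (p147096) and `…SmoothForce.lean` (`smoothForce_steady_upgrade`: the steady upgrade for ARBITRARY smooth forces in
ε–δ form — census door R3, steady half, as a theorem: a steady-loud smooth force is a `C^∞`-limit of forces carrying an `L²`-ball of relaxed-loud
smooth admissible forces).

Open: `stub_residual_c14` below — the wild residual over `tamePoly = tameUnfold ∪ polySteady`; by `RobustLoudUpgrade_iff_wild_c14` it IS the
crux modulo the landed theorems (census W1 minus the finite-spectrum steady witnesses); not claimed closable inside this line.
-/

set_option linter.dupNamespace false

noncomputable section

open scoped BigOperators Topology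
open Filter Set Function TopologicalSpace MeasureTheory

namespace Summit.AnomalousDissipation.AnomalousDissipation.Theorems.RobustLoudUpgrade

open Literature.Analysis.FunctionSpaces Literature.Analysis.FunctionSpaces.Torus
open Literature.Analysis.FluidPDE
open Summit.AnomalousDissipation.AnomalousDissipation.Theses.BaireTransfer
open Summit.AnomalousDissipation.AnomalousDissipation.Theorems.RobustLoudUpgrade.Unfolding
open Summit.AnomalousDissipation.AnomalousDissipation.Theorems.RobustLoudUpgrade.WildResidual

namespace Poly

/-! ## §1 The one open stub: the wild residual over `tamePoly` (≡ the crux modulo the landed classes) -/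

/-- **stub_residual_c14** (the residual of the reshape c14; crux-hard — EQUIVALENT to the crux by `Poly.RobustLoudUpgrade_iff_wild_c14`):
for some finite stock `S₀`, in every family `P_S`, `S ⊇ S₀`, at every pair of budgets and every level, the loud forces that are NOT limits
of `tamePoly`-witnessed forces at the relaxed budgets lie in the closure of the robustly relaxed-loud forces.  Open content: the census's
coincidence set W1 (elliptic ghosts, locked sheets, non-normally-hyperbolic Goldstone families, Floquet twins) minus the witnesses of finite
Fourier support. [folklore] -/
theorem stub_residual_c14 :
    ∃ S₀ : Finset (Fin 3 → ℤ), ∀ S : Finset (Fin 3 → ℤ), S₀ ⊆ S → ∀ (E ε : ℝ), 0 < ε → ∀ j : ℕ,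
      loud S (1 / ((j : ℝ) + 1)) E ε \ closure (tamePoly S (1 / ((j : ℝ) + 1)) (2 * E) (ε / 2)) ⊆
        closure (interior (loud S (1 / ((j : ℝ) + 1)) (2 * E) (ε / 2))) := by
  sorry

/-! ## §2 Bookkeeping (sorry-free): earlier residuals imply this one; the crux implies it -/

/-- The registered c6 residual implies the c14 residual (landed `Poly.residual_c14_of_c6`). [folklore] -/
theorem residual_c14_of_c6'
    (h6 : ∃ S₀ : Finset (Fin 3 → ℤ), ∀ S : Finset (Fin 3 → ℤ), S₀ ⊆ S → ∀ (E ε : ℝ), 0 < ε → ∀ j : ℕ,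
      loud S (1 / ((j : ℝ) + 1)) E ε \ closure (tameUnfold S (1 / ((j : ℝ) + 1)) (2 * E) (ε / 2)) ⊆
        closure (interior (loud S (1 / ((j : ℝ) + 1)) (2 * E) (ε / 2)))) :
    ∃ S₀ : Finset (Fin 3 → ℤ), ∀ S : Finset (Fin 3 → ℤ), S₀ ⊆ S → ∀ (E ε : ℝ), 0 < ε → ∀ j : ℕ,
      loud S (1 / ((j : ℝ) + 1)) E ε \ closure (tamePoly S (1 / ((j : ℝ) + 1)) (2 * E) (ε / 2)) ⊆
        closure (interior (loud S (1 / ((j : ℝ) + 1)) (2 * E) (ε / 2))) :=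
  residual_c14_of_c6 h6

/-- The crux implies the c14 residual (so `stub_residual_c14 ↔ RobustLoudUpgrade`, landed as `RobustLoudUpgrade_iff_wild_c14`). [folklore] -/
theorem residual_c14_of_crux' (h : RobustLoudUpgrade) :
    ∃ S₀ : Finset (Fin 3 → ℤ), ∀ S : Finset (Fin 3 → ℤ), S₀ ⊆ S → ∀ (E ε : ℝ), 0 < ε → ∀ j : ℕ,
      loud S (1 / ((j : ℝ) + 1)) E ε \ closure (tamePoly S (1 / ((j : ℝ) + 1)) (2 * E) (ε / 2)) ⊆
        closure (interior (loud S (1 / ((j : ℝ) + 1)) (2 * E) (ε / 2))) :=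
  RobustLoudUpgrade_iff_wild_c14.1 h

/-! ## §3 Composition (sorry-free): the crux BY NAME -/

/-- **Composition (lead c14, v3): the landed class theorem `polySteady_subset_closure_interior_loud` and the registered residual prove the
crux `RobustLoudUpgrade` BY NAME through the landed glue `line_glue_c14`.** [folklore] -/
theorem RobustLoudUpgrade_of : RobustLoudUpgrade :=
  line_glue_c14 polySteady_subset_closure_interior_loud stub_residual_c14

end Poly

end Summit.AnomalousDissipation.AnomalousDissipation.Theorems.RobustLoudUpgrade

end
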